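/-
Origin: expansion seat `planner-pub-hodgecm-pohl-g15-0`, handover #13 2026-08-18T16:19:39Z (md5 791d3659a95e2baf351968d78f3e4d83, 361 l.; RUN-32 CANDIDATE ROW, ON REQUEST ONLY — TREE-SHAPE SPLIT (≤400 l.) of the pohl lineage, source lines verbatim; REPLACES HodgeCM/Proofs/Pohlmann/GaloisSpanCriterion.lean in place (module name kept ⇒ no importer edits); lands AFTER GaloisSpanCondition; rewrites import Pohl15.GaloisSpanCondition -> HodgeCM.Proofs.Pohlmann.GaloisS (`HOME/pub-hodgecm-pohl-g15/lean/Pohl15/GaloisSpanCriterion.lean`, md5 791d3659, 361 lines);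
landed by the packager successor (mc-unitary-1-g3, gen-8 kit) in gate run 32 REPLACES the earlier landed copy of `HodgeCM/Proofs/Pohlmann/GaloisSpanCriterion.lean` (import ^import Pohl15\.GaloisSpanCondition[ \t]*$→import HodgeCM.Proofs.Pohlmann.GaloisSpanCondition ×1).
-/
/-
Copyright: pub-hodgecm formalisation cell (harness21, 2026). New file (not vendored).
Origin: HOME/pub-hodgecm-pohl-g15/lean/Pohl15/GaloisSpanCriterion.lean — session planner-pub-hodgecm-pohl-g15-0 (unit pub-hodgecm-pohl-g15),
EXPANSION part (b) `PohlmannSpan`, generation 15: TREE-SHAPE STAGING under the 400-line rule of lean/CONVENTIONS.md §2 — part 2/2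
of the split of `HodgeCM/Proofs/Pohlmann/GaloisSpanCriterion.lean` (pohl-g13, gate run 30; 556 l., md5 8c9eaa98b30c): source lines 269–556 VERBATIM; the module docstring below is the source's, with one `Layout` sentence appended.
Intended final place: `HodgeCM/Proofs/Pohlmann/GaloisSpanCriterion.lean` (module `HodgeCM.Proofs.Pohlmann.GaloisSpanCriterion`); WIP import `Pohl15.GaloisSpanCondition` → `HodgeCM.Proofs.Pohlmann.GaloisSpanCondition` on landing.  The LAST part keeps the old module name, so no importer changes.
-/
import Summits.HodgeConjecture.HodgeCM.Proofs.Pohlmann.GaloisSpanCondition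

/-!
# When do the two index sets agree?  A field-level criterion by linear algebra on `Hom(F, ℂ)`

`NaiveSpanCriterion.lean` (pohl-g12) proves: in every universe with the model axioms and N1–N3, the NAIVE Pohlmann span at `(F, Θ, p)`
(the body of `PohlmannSpan` with `IsGalois ℚ F` deleted) holds iff `NonGalois.IndexSetsAgree Θ p` — every Galois-closure Hodge weight
(`IsHodgeWeightC`: the count condition for `σ ∈ Gal(E^c/ℚ)`, `E = F^{n+1}`) is an old Hodge weight (`IsHodgeWeight`: the count
condition for every Galois translate `P ∈ GalT F`).  Two sufficient conditions were known in the kernel (`IsGalois ℚ F`;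
`galTOf` surjective) and one family of failures (`AutPair F` + a Galois-stable type).  Its GAPS record pohlg12-K1 leaves open WHICH
fields satisfy `IndexSetsAgree` at every `(n, Θ, p)`.

This file DECIDES that question by LINEAR ALGEBRA on the finite set `Hom(F, ℂ)`, with no universe and no cohomology:

* `NonGalois.antiInd g` — the antisymmetrised graph `a_g(s, x) = [g s = x] − [conj (g s) = x]` of a self-map `g` of `Hom(F, ℂ)`;
  `NonGalois.galAntiSpan F n` — the `ℚ`-span of the `a_σ`, `σ ∈ Gal(E^c/ℚ)` acting on `Hom(F, ℂ)` by `GaoUllmo.galF n` (`E = F^{n+1}`);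
* `NonGalois.GalSpanCondition F n` — for every Galois translate `P ∈ GalT F`, `a_P ∈ galAntiSpan F n`.

**Theorem A (sufficiency)** `NonGalois.indexSetsAgree_of_galSpanCondition`: `GalSpanCondition F n` implies `IndexSetsAgree Θ p` for
EVERY family `Θ` of `n + 1` CM types of `F` and every `p`.  Proof: for a CM type `Θ`, `Σ_x 1_Θ(x) a_g(s, x) = 2·1_Θ(g s) − 1`
(`sum_ind_mul_antiInd`, from `1_Θ(y) + 1_Θ(ȳ) = 1`), so the count `Σ_j Σ_{s ∈ S_j} 1_{Θ_j}(g s)` is an AFFINE function of `a_g`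
(`weightPairing_antiInd`); a Galois-closure Hodge weight makes it take the value `p` at every `a_σ`, hence on their affine span, hence
at `a_P`.  Both kernel-known sufficient conditions are instances (`galSpanCondition_of_galTOf_surjective`, `galSpanCondition_of_isGalois`:
each `a_P` IS an `a_σ`).

**Level independence** `NonGalois.galAntiSpan_eq`, `NonGalois.galSpanCondition_iff`: the span — hence the condition — does not
depend on the number of factors `n + 1` (`galoisClosure_pi_eq`: the Galois closures of `F^{n+1} → ℂ` inside `ℂ` coincide for all `n`,
and `range_galF_eq`: the induced self-maps of `Hom(F, ℂ)` are the same set).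

**Theorem B (necessity)** `NonGalois.galSpanCondition_of_indexSetsAgree` (`F` totally complex, e.g. a CM field): if the index sets
agree at every `(m, Θ, p)`, then `GalSpanCondition F n`.  Proof (`exists_isHodgeWeightC_of_not_mem`): if `a_g ∉ galAntiSpan F n`, a
separating functional `f` (`Submodule.exists_dual_map_eq_bot_of_notMem`) with natural-number coordinates `m'(s, x)` (clear
denominators, then shift by a constant — harmless since `Σ_q a_{g'}(q) = 0`) is REALISED as a count: take the pair of CM types
(type through `x`, its partner), which jointly see only the place of `x` (`ind_typeThrough_add_ind_partnerType`:
`1_Θ(y) + 1_{Θ'}(y) = 1 + [y = x] − [ȳ = x]`), each with the singleton weight `{s}`, repeated `m'(s, x)` times; the count of this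
family at any self-map `g'` is `p + D·f(a_{g'})` (`sum_ind_fam`), `D > 0`: it is `p` at every `σ` (so the weight is a Galois-closure
Hodge weight) and not `p` at `g`.

**The criterion** `NonGalois.galSpanCondition_iff_indexSetsAgree`: for `F` totally complex,
`GalSpanCondition F n ↔ ∀ m Θ p, IndexSetsAgree Θ p`; and through pohl-g12's criterion, for a CM field in a universe with the model
axioms and N1–N3, `Universe.forall_naivePohlmannSpanAt_iff_galSpanCondition`:
`(∀ n Θ p, U.NaivePohlmannSpanAt F Θ p) ↔ GalSpanCondition F 0` — the naive Pohlmann span holds for ALL families of CM types of `F`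
iff the finite linear-algebra condition `LIN(F)` on `Hom(F, ℂ)` holds.  (Per-`(Θ, p)` sufficiency: `Universe.naivePohlmannSpanAt_of_galSpanCondition`.)

Nothing is posited; every hypothesis is explicit.  Source of the surrounding mathematics: Gao–Ullmo, arXiv:2411.12249, Thm 3.1 and its
proof (art. p. 9) — the condition (3.2) there quantifies over `G = Gal(E^c/ℚ)`, which is `IsHodgeWeightC`; the comparison with the
package's older `GalT F`-form, and the criterion of this file, are internal to this package (pohl-g9 … g13) and are not claims of the source.

Layout (2026-08-18, tree 400-line rule): `section AntiInd` / `section Level` (the Galois span condition and its level independence; former first half of this file) are now `GaloisSpanCondition.lean`, imported here; all statements verbatim.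
-/

noncomputable section

open scoped TensorProduct NumberField BigOperators
open NumberField NumberField.ComplexEmbedding

attribute [local instance] Classical.propDecidable

namespace HodgeCM

open Literature.AlgebraicGeometry.Motives (CMType HodgeStructure)
open Literature.AlgebraicGeometry.Motives.HodgeStructure (ofRat ofRat_apply)
open HodgeCM.Pohlmann HodgeCM.GaoUllmo HodgeCM.CMTypeOps

namespace NonGalois

/-! ### Necessity: a self-map outside the Galois span is detected by a Galois-closure Hodge weight -/

section Necessity

/-! #### Linear-algebra preliminaries -/

/-- A linear functional on `ι → ℚ` in coordinates. -/
theorem dual_apply_eq_sum {ι : Type} [Fintype ι] [DecidableEq ι] (f : Module.Dual ℚ (ι → ℚ)) (h : ι → ℚ) :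
    f h = ∑ i, h i * f (Pi.single i 1) := by
  conv_lhs => rw [pi_eq_sum_univ' h]
  simp only [map_sum, map_smul, smul_eq_mul]

/-- Clearing the denominators of finitely many rationals. -/
theorem exists_int_eq_mul {ι : Type} [Fintype ι] (t : ι → ℚ) :
    ∃ D : ℕ, 0 < D ∧ ∃ m : ι → ℤ, ∀ i, (m i : ℚ) = D * t i := by
  refine ⟨∏ i, (t i).den, Finset.prod_pos fun i _ => (t i).den_pos,
    fun i => (t i).num * (((∏ j, (t j).den) / (t i).den : ℕ) : ℤ), fun i => ?_⟩
  obtain ⟨k, hk⟩ := Finset.dvd_prod_of_mem (fun j => (t j).den) (Finset.mem_univ i)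
  dsimp only
  rw [hk, Nat.mul_div_cancel_left k (t i).den_pos]
  push_cast
  rw [← Rat.mul_den_eq_num (t i)]
  ring

/-- `Σ_{ℓ < K} [ℓ < c] · a = c · a` for `c ≤ K`. -/
theorem sum_fin_ite_lt {R : Type} [NonAssocSemiring R] (K c : ℕ) (hc : c ≤ K) (a : R) :
    ∑ ℓ : Fin K, (if (ℓ : ℕ) < c then a else 0) = c * a := by
  rw [Finset.sum_ite, Finset.sum_const_zero, add_zero, Finset.sum_const, nsmul_eq_mul, Fin.card_filter_val_lt,
    min_eq_right hc]

/-! #### The detecting family: index set and weights -/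

section Weights

variable {F : Type} [Field F]

variable (F) in
/-- Index set of the detecting family: a pair `q = (s, x)` of embeddings, a level `ℓ < K`, and a bit (type through `x` / its partner). -/
abbrev LevelIndex (K : ℕ) : Type := ((F →+* ℂ) × (F →+* ℂ)) × Fin K × Bool

/-- The weights of the detecting family: factor `((s, x), ℓ, b)` carries `{s}` if `ℓ < m'(s, x)` and nothing otherwise — so the pair
`(s, x)` is used with multiplicity `m'(s, x)`, once with the type through `x` and once with its partner. -/
def famWeight {K : ℕ} (m' : (F →+* ℂ) × (F →+* ℂ) → ℕ) (j : LevelIndex F K) : Finset (F →+* ℂ) :=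
  if (j.2.1 : ℕ) < m' j.1 then {j.1.1} else ∅

/-- (Ported verbatim from the HodgeCMPerL package; no docstring in the source.) -/
theorem sum_famWeight {K : ℕ} (m' : (F →+* ℂ) × (F →+* ℂ) → ℕ) (q : (F →+* ℂ) × (F →+* ℂ)) (ℓ : Fin K) (b : Bool)
    {M : Type} [AddCommMonoid M] (h : (F →+* ℂ) → M) :
    ∑ s ∈ famWeight m' (q, ℓ, b), h s = if (ℓ : ℕ) < m' q then h q.1 else 0 := by
  unfold famWeight
  split_ifs <;> simp

/-- (Ported verbatim from the HodgeCMPerL package; no docstring in the source.) -/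
theorem card_famWeight {K : ℕ} (m' : (F →+* ℂ) × (F →+* ℂ) → ℕ) (q : (F →+* ℂ) × (F →+* ℂ)) (ℓ : Fin K) (b : Bool) :
    (famWeight m' (q, ℓ, b)).card = if (ℓ : ℕ) < m' q then 1 else 0 := by
  unfold famWeight
  split_ifs <;> simp

variable [NumberField F]

/-- Total size of the detecting family's weight: `2 Σ_q m'(q)`. -/
theorem sum_card_famWeight {K : ℕ} (m' : (F →+* ℂ) × (F →+* ℂ) → ℕ) (hK : ∀ q, m' q ≤ K) :
    ∑ j : LevelIndex F K, (famWeight m' j).card = 2 * ∑ q, m' q := by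
  have hq : ∀ q : (F →+* ℂ) × (F →+* ℂ), ∑ lb : Fin K × Bool, (famWeight m' (q, lb)).card = 2 * m' q := fun q =>
    calc ∑ lb : Fin K × Bool, (famWeight m' (q, lb)).card
        = ∑ ℓ : Fin K, ∑ b : Bool, (famWeight m' (q, ℓ, b)).card :=
          Fintype.sum_prod_type fun lb : Fin K × Bool => (famWeight m' (q, lb)).card
      _ = ∑ ℓ : Fin K, 2 * (if (ℓ : ℕ) < m' q then 1 else 0) :=
          Finset.sum_congr rfl fun ℓ _ => by rw [Fintype.sum_bool, card_famWeight, card_famWeight, two_mul]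
      _ = 2 * m' q := by rw [← Finset.mul_sum, sum_fin_ite_lt K (m' q) (hK q) (1 : ℕ), mul_one, Nat.cast_id]
  calc ∑ j : LevelIndex F K, (famWeight m' j).card
      = ∑ q : (F →+* ℂ) × (F →+* ℂ), ∑ lb : Fin K × Bool, (famWeight m' (q, lb)).card :=
        Fintype.sum_prod_type fun j : LevelIndex F K => (famWeight m' j).card
    _ = ∑ q : (F →+* ℂ) × (F →+* ℂ), 2 * m' q := Finset.sum_congr rfl fun q _ => hq q
    _ = 2 * ∑ q, m' q := (Finset.mul_sum _ _ _).symm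

end Weights

/-! #### The detecting family: CM types seeing one place only -/

section Types

variable {F : Type} [Field F] [IsTotallyComplex F]

/-- (Ported verbatim from the HodgeCMPerL package; no docstring in the source.) -/
theorem conjugate_ne (x : F →+* ℂ) : conjugate x ≠ x := fun h =>
  IsTotallyComplex.complexEmbedding_not_isReal x (ComplexEmbedding.isReal_iff.mpr h)

variable (F) in
/-- A CM type of the totally complex field `F`: the distinguished embedding of each infinite place. -/
def placesType : CMType F :=
  ⟨{φ | (InfinitePlace.mk φ).embedding = φ}, fun φ => by
    have hor : (InfinitePlace.mk φ).embedding = φ ∨ (InfinitePlace.mk φ).embedding = conjugate φ := by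
      rcases InfinitePlace.mk_eq_iff.mp (InfinitePlace.mk_embedding (InfinitePlace.mk φ)) with h | h
      · exact Or.inl h
      · right
        have h' := congrArg conjugate h
        rwa [(involutive_conjugate F) _] at h'
    simp only [Set.mem_setOf_eq, InfinitePlace.mk_conjugate_eq]
    exact ⟨fun h1 h2 => conjugate_ne φ (h2.symm.trans h1), fun h2 => hor.resolve_right h2⟩⟩

/-- A CM type THROUGH `x` (one containing `x`). -/
def typeThrough (x : F →+* ℂ) : CMType F :=
  if x ∈ (placesType F).1 then placesType F else bar (placesType F)

/-- (Ported verbatim from the HodgeCMPerL package; no docstring in the source.) -/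
theorem mem_typeThrough (x : F →+* ℂ) : x ∈ (typeThrough x).1 := by
  unfold typeThrough
  split_ifs with h
  · exact h
  · rwa [mem_bar_iff]

/-- Its PARTNER: equal to it at the place of `x`, complementary at every other place. -/
def partnerType (x : F →+* ℂ) : CMType F :=
  CMTypeOps.flip x (bar (typeThrough x))

/-- The pair (type through `x`, its partner) sees only the place of `x`: `1_Θ(y) + 1_{Θ'}(y) = 1 + [y = x] − [ȳ = x]`. -/
theorem ind_typeThrough_add_ind_partnerType (x y : F →+* ℂ) :
    (ind (typeThrough x) y : ℚ) + ind (partnerType x) y =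
      1 + ((if y = x then 1 else 0) - (if conjugate y = x then 1 else 0)) := by
  have hx := mem_typeThrough x
  have hne := conjugate_ne x
  unfold partnerType
  by_cases hy : y ∈ placeSet x
  · rw [ind_flip_of_mem hy, ind_bar]
    rcases hy with hy | hy
    · subst hy
      rw [ind_of_mem hx, if_pos rfl, if_neg hne]
      norm_num
    · rw [Set.mem_singleton_iff] at hy
      subst hy
      rw [ind_of_not_mem ((mem_iff_conjugate_notMem _ x).mp hx), if_neg hne, if_pos ((involutive_conjugate F) x)]
      norm_num
  · rw [ind_flip_of_not_mem hy, ind_bar]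
    have h1 : y ≠ x := fun h => hy (by rw [h]; exact Set.mem_insert _ _)
    have h2 : conjugate y ≠ x := fun h =>
      hy ((conjugate_mem_placeSet_iff x y).mp (by rw [h]; exact Set.mem_insert _ _))
    rw [if_neg h1, if_neg h2]
    push_cast
    ring

/-- The types of the detecting family: the type through `x` (bit `false`) or its partner (bit `true`) on factor `((s, x), ℓ, b)`. -/
def famType {K : ℕ} (j : LevelIndex F K) : CMType F :=
  bif j.2.2 then partnerType j.1.2 else typeThrough j.1.2

variable [NumberField F]

/-- **The count of the detecting family** at a self-map `g` of `Hom(F, ℂ)`: `Σ_q m'(q) + Σ_q m'(q) a_g(q)`. -/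
theorem sum_ind_fam {K : ℕ} (m' : (F →+* ℂ) × (F →+* ℂ) → ℕ) (hK : ∀ q, m' q ≤ K) (g : (F →+* ℂ) → (F →+* ℂ)) :
    (∑ j : LevelIndex F K, ∑ s ∈ famWeight m' j, (ind (famType j) (g s) : ℚ)) =
      (∑ q, (m' q : ℚ)) + ∑ q, (m' q : ℚ) * antiInd g q := by
  have hℓ : ∀ (q : (F →+* ℂ) × (F →+* ℂ)) (ℓ : Fin K),
      (∑ b : Bool, ∑ s ∈ famWeight m' (q, ℓ, b), (ind (famType (q, ℓ, b)) (g s) : ℚ)) =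
        if (ℓ : ℕ) < m' q then 1 + antiInd g q else 0 := by
    intro q ℓ
    simp only [sum_famWeight, Fintype.sum_bool, famType, cond_true, cond_false]
    split_ifs with h
    · rw [add_comm, ind_typeThrough_add_ind_partnerType q.2 (g q.1), antiInd_apply]
    · rw [add_zero]
  have hq : ∀ q : (F →+* ℂ) × (F →+* ℂ),
      (∑ lb : Fin K × Bool, ∑ s ∈ famWeight m' (q, lb), (ind (famType (q, lb)) (g s) : ℚ)) = m' q + m' q * antiInd g q :=
    fun q =>
    calc (∑ lb : Fin K × Bool, ∑ s ∈ famWeight m' (q, lb), (ind (famType (q, lb)) (g s) : ℚ))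
        = ∑ ℓ : Fin K, ∑ b : Bool, ∑ s ∈ famWeight m' (q, ℓ, b), (ind (famType (q, ℓ, b)) (g s) : ℚ) :=
          Fintype.sum_prod_type fun lb : Fin K × Bool => ∑ s ∈ famWeight m' (q, lb), (ind (famType (q, lb)) (g s) : ℚ)
      _ = ∑ ℓ : Fin K, (if (ℓ : ℕ) < m' q then 1 + antiInd g q else 0) := Finset.sum_congr rfl fun ℓ _ => hℓ q ℓ
      _ = m' q + m' q * antiInd g q := by rw [sum_fin_ite_lt K (m' q) (hK q), mul_add, mul_one]
  calc (∑ j : LevelIndex F K, ∑ s ∈ famWeight m' j, (ind (famType j) (g s) : ℚ))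
      = ∑ q : (F →+* ℂ) × (F →+* ℂ), ∑ lb : Fin K × Bool, ∑ s ∈ famWeight m' (q, lb), (ind (famType (q, lb)) (g s) : ℚ) :=
        Fintype.sum_prod_type fun j : LevelIndex F K => ∑ s ∈ famWeight m' j, (ind (famType j) (g s) : ℚ)
    _ = ∑ q : (F →+* ℂ) × (F →+* ℂ), ((m' q : ℚ) + m' q * antiInd g q) := Finset.sum_congr rfl fun q _ => hq q
    _ = (∑ q, (m' q : ℚ)) + ∑ q, (m' q : ℚ) * antiInd g q := Finset.sum_add_distrib

end Types

/-! #### The theorem -/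

variable {F : Type} [Field F] [NumberField F]

/-- **A self-map outside the Galois span is detected.**  If `a_g ∉ galAntiSpan F n` (`F` totally complex), there are a number of
factors `m + 1`, a family `Θ` of CM types of `F`, a `p` and a weight `S` such that `S` IS a Galois-closure Hodge weight of `(Θ, p)`
while the count `#{(j, s) : s ∈ S_j, g s ∈ Θ_j}` is NOT `p`.  (A separating functional with natural-number coordinates `m'` is
realised by the detecting family; its count at any `g'` is `p + D·f(a_{g'})`, `D > 0`.) -/
theorem exists_isHodgeWeightC_of_not_mem [IsTotallyComplex F] {n : ℕ} {g : (F →+* ℂ) → (F →+* ℂ)}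
    (hg : antiInd g ∉ galAntiSpan F n) :
    ∃ (m : ℕ) (Θ : Fin (m + 1) → CMType F) (p : ℕ) (S : Fin (m + 1) → Finset (F →+* ℂ)),
      IsHodgeWeightC Θ p S ∧ (∑ j, ∑ s ∈ S j, ind (Θ j) (g s)) ≠ (p : ℤ) := by
  -- a separating functional `f`; its coordinates `f(e_q)`
  obtain ⟨f, hfg, hf0⟩ := Submodule.exists_dual_map_eq_bot_of_notMem hg inferInstance
  have hf0' : ∀ a ∈ galAntiSpan F n, f a = 0 := fun a ha =>
    (Submodule.eq_bot_iff _).mp hf0 _ (Submodule.mem_map_of_mem ha)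
  have hft : ∀ a, f a = ∑ q, a q * f (Pi.single q 1) := dual_apply_eq_sum f
  -- integer coordinates `m = D · f(e_q)`, shifted to natural numbers `m' = m + B`
  obtain ⟨D, hD, m, hm⟩ := exists_int_eq_mul fun q : (F →+* ℂ) × (F →+* ℂ) => f (Pi.single q 1)
  obtain ⟨B, hmB⟩ : ∃ B : ℕ, ∀ q, 0 ≤ m q + B := by
    refine ⟨∑ q, (m q).natAbs, fun q => ?_⟩
    have h1 : |m q| ≤ ((∑ q', (m q').natAbs : ℕ) : ℤ) := by
      push_cast
      exact Finset.single_le_sum (f := fun q' => |m q'|) (fun _ _ => abs_nonneg _) (Finset.mem_univ q)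
    have h2 := neg_abs_le (m q)
    linarith
  obtain ⟨m', hm'⟩ : ∃ m' : (F →+* ℂ) × (F →+* ℂ) → ℕ, ∀ q, (m' q : ℤ) = m q + B :=
    ⟨fun q => (m q + B).toNat, fun q => Int.toNat_of_nonneg (hmB q)⟩
  have hm'q : ∀ q, (m' q : ℚ) = D * f (Pi.single q 1) + B := fun q => by
    have h := congrArg (fun z : ℤ => (z : ℚ)) (hm' q)
    push_cast at h
    rw [h, hm q]
  -- the key identity: `Σ_q m'(q) a(q) = D f(a) + B Σ_q a(q)`
  have hkey : ∀ a : (F →+* ℂ) × (F →+* ℂ) → ℚ, ∑ q, (m' q : ℚ) * a q = D * f a + B * ∑ q, a q := fun a => by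
    rw [hft a, Finset.mul_sum, Finset.mul_sum, ← Finset.sum_add_distrib]
    refine Finset.sum_congr rfl fun q _ => ?_
    rw [hm'q q]
    ring
  -- enough levels
  obtain ⟨K, hK0, hKq⟩ : ∃ K : ℕ, 0 < K ∧ ∀ q, m' q ≤ K :=
    ⟨Finset.univ.sup m' + 1, Nat.succ_pos _, fun q => (Finset.le_sup (Finset.mem_univ q)).trans (Nat.le_succ _)⟩
  -- the index set is nonempty: reindex it by some `Fin (N + 1)`
  have hne0 : antiInd g ≠ 0 := fun h => hfg (by rw [h, map_zero])
  obtain ⟨q₀, -⟩ := Function.ne_iff.mp hne0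
  obtain ⟨N, ⟨e⟩⟩ : ∃ N : ℕ, Nonempty (Fin (N + 1) ≃ LevelIndex F K) := by
    have hN : 0 < Fintype.card (LevelIndex F K) := Fintype.card_pos_iff.mpr ⟨(q₀, ⟨0, hK0⟩, false)⟩
    exact ⟨Fintype.card (LevelIndex F K) - 1, ⟨(finCongr (Nat.sub_add_cancel hN)).trans (Fintype.equivFin _).symm⟩⟩
  refine ⟨N, fun i => famType (e i), ∑ q, m' q, fun i => famWeight m' (e i), ⟨?_, fun σ => ?_⟩, ?_⟩
  · -- total size `2p`
    exact (Fintype.sum_equiv e _ (fun j => (famWeight m' j).card) fun i => rfl).trans (sum_card_famWeight m' hKq)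
  · -- every `σ ∈ Gal(E^c/ℚ)` counts `p`: `a_σ` lies in the Galois span (at any level), `f` kills it, and `Σ_q a_σ(q) = 0`
    have hσ : antiInd (galF N σ) ∈ galAntiSpan F n := by
      rw [galAntiSpan_eq n N]
      exact antiInd_galF_mem_galAntiSpan σ
    have hq : (∑ j : LevelIndex F K, ∑ s ∈ famWeight m' j, (ind (famType j) (galF N σ s) : ℚ)) = ∑ q, (m' q : ℚ) := by
      rw [sum_ind_fam m' hKq, hkey, hf0' _ hσ, sum_antiInd, mul_zero, mul_zero, add_zero, add_zero]
    have hz : (∑ j : LevelIndex F K, ∑ s ∈ famWeight m' j, ind (famType j) (galF N σ s)) = ((∑ q, m' q : ℕ) : ℤ) := by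
      exact_mod_cast hq
    exact (Fintype.sum_equiv e _ (fun j => ∑ s ∈ famWeight m' j, ind (famType j) (galF N σ s)) fun i => rfl).trans hz
  · -- but `g` counts `p + D f(a_g) ≠ p`
    rw [Fintype.sum_equiv e _ (fun j => ∑ s ∈ famWeight m' j, ind (famType j) (g s)) fun i => rfl]
    intro hz
    have hq : (∑ j : LevelIndex F K, ∑ s ∈ famWeight m' j, (ind (famType j) (g s) : ℚ)) = ∑ q, (m' q : ℚ) := by
      exact_mod_cast hz
    rw [sum_ind_fam m' hKq, hkey, sum_antiInd, mul_zero, add_zero, add_eq_left] at hq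
    exact hfg ((mul_eq_zero.mp hq).resolve_left (by exact_mod_cast hD.ne'))

/-- **THEOREM (necessity of the Galois span condition).**  If the two index sets agree at every `(Θ, p)` on any number of factors
(`F` totally complex), then `F` satisfies the Galois span condition. -/
theorem galSpanCondition_of_indexSetsAgree [IsTotallyComplex F] (n : ℕ)
    (h : ∀ (m : ℕ) (Θ : Fin (m + 1) → CMType F) (p : ℕ), IndexSetsAgree Θ p) : GalSpanCondition F n := by
  intro P
  by_contra hP
  obtain ⟨m, Θ, p, S, hS, hne⟩ := exists_isHodgeWeightC_of_not_mem hP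
  exact hne ((h m Θ p S hS).2 P)

/-- **THE FIELD-LEVEL CRITERION.**  For a totally complex number field `F` (and any `n`): the Galois span condition holds iff the
two index sets agree at every `(Θ, p)` on every number of factors. -/
theorem galSpanCondition_iff_indexSetsAgree [IsTotallyComplex F] (n : ℕ) :
    GalSpanCondition F n ↔ ∀ (m : ℕ) (Θ : Fin (m + 1) → CMType F) (p : ℕ), IndexSetsAgree Θ p :=
  ⟨fun h m Θ p => indexSetsAgree_of_galSpanCondition ((galSpanCondition_iff n m).mp h) Θ p,
    galSpanCondition_of_indexSetsAgree n⟩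

end Necessity

end NonGalois

/-! ### Through pohl-g12's criterion: the naive span under the Galois span condition -/

namespace Universe

open NonGalois

variable {U : Universe}

/-- In every universe with the model axioms and N1–N3: if the CM field `F` satisfies the Galois span condition on `n + 1` factors,
the NAIVE Pohlmann span (old index set `IsHodgeWeight`, no `IsGalois` hypothesis) holds at every `(Θ, p)` on `n + 1` factors. -/
theorem naivePohlmannSpanAt_of_galSpanCondition (M : U.ModelAxioms) (hN1 : U.Fact_cupExterior) (hN2 : U.Fact_cup_hodge)
    (hN3 : U.Fact_pull_H0) {F : CMField} {n : ℕ} (hF : GalSpanCondition F n) (Θ : Fin (n + 1) → CMType F) (p : ℕ) :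
    U.NaivePohlmannSpanAt F Θ p :=
  naivePohlmannSpanAt_of_indexSetsAgree M hN1 hN2 hN3 p (indexSetsAgree_of_galSpanCondition hF Θ p)

/-- **THE ANSWER TO "FOR WHICH CM FIELDS DOES THE NAIVE POHLMANN SPAN HOLD?"**  In every universe with the model axioms and N1–N3,
for every CM field `F`: the naive Pohlmann span holds at EVERY `(n, Θ, p)` iff `F` satisfies the Galois span condition — a statement
of linear algebra on the finite `Gal(E^c/ℚ) × Aut(F/ℚ)`-set `Hom(F, ℂ)`.  (pohl-g12's criterion `naivePohlmannSpanAt_iff_indexSetsAgree`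
+ `galSpanCondition_iff_indexSetsAgree`.) -/
theorem forall_naivePohlmannSpanAt_iff_galSpanCondition (M : U.ModelAxioms) (hN1 : U.Fact_cupExterior)
    (hN2 : U.Fact_cup_hodge) (hN3 : U.Fact_pull_H0) (F : CMField) :
    (∀ (n : ℕ) (Θ : Fin (n + 1) → CMType F) (p : ℕ), U.NaivePohlmannSpanAt F Θ p) ↔ GalSpanCondition F 0 := by
  rw [galSpanCondition_iff_indexSetsAgree 0]
  exact forall₃_congr fun n Θ p => naivePohlmannSpanAt_iff_indexSetsAgree M hN1 hN2 hN3 p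

end Universe

end HodgeCM

end
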